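import Summits.ResolutionOfSingularities.ResolutionOfSingularities.Theorems.FrobeniusLadderFInjectiveMacaulayficationB9Specimen
import Summits.ResolutionOfSingularities.ResolutionOfSingularities.Theorems.FrobeniusLadderFInjectiveMacaulayficationPointFloorNotFullOfFedder
import HarnessLib

/-!
# BED B9 `z² + x⁹ + y⁹ + u⁹ + t⁹`: THE POINT FLOOR IS A LEGAL INPUT AND IS NOT FULL — FOR EVERY PRIME `p ∤ 18` (a p-UNIFORM negative certificate)
# (crux `FInjectiveMacaulayfication` stmt-ResolutionOfSingularities-15315, chain w45a; res-L1-w45a-plan-1 RULING R22.7 (b) «B9 INPUT SIDE p-uniform in `PointFloorNotFullOfFedder` currency: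
# point floor LEGAL, and ★ NOT FULL for EVERY p ∤ 18 at the x-chart point of the floor (germ z′² + x⁷·unit: (z′²+x⁷v)^{p−1} ∈ 𝔪^{[p]} since 2a ≤ p−1 and 7(p−1−a) ≤ p−1 are
# incompatible)»; seat res-L1-w45a-stub-1 g13; templates ✓ `X2Cubic4PointFloor` (legal) and ✓ `FDPointFloor` (not full); first-step memo res-L1-w45a-tri-2 g19 `B9-GENERIC-P-FSIDE-tri2.md`)

[OURS · L1 W4.5a] Support file (`--supports stmt-ResolutionOfSingularities-15315 --as helper`); def-free, unconditional; replaces the role of NO printed item; NOT a statement of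
the manuscript; AI-written (AI review is weaker than expert review).

* §1 `theta` — the five point-blow-up chart identities `θᵢ f = Xᵢ² · gᵢ` (`g_x = z² + x⁷(1 + y⁹ + u⁹ + t⁹)`, …, `g_z = 1 + z⁷(x⁹+y⁹+u⁹+t⁹)`), `g_not_mem_span_X`, `constantCoeff_g_zero`.
* §2 ★ `pointFloor_b9_input_legal` (`2, 3 ≠ 0` in `k`) — for every blowing up `g : S′ → Spec 𝒪_{X,v}` along the point floor: `I ≠ ⊥`, `Supp I ⊆ Singᶜᶜ`, `S′` regular off the closed
  fibre, CM everywhere (✓ `PointFloorLegalOfIsolated.pointFloor_input_legal`).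
* §3 ★★ `g_zero_pow_mem_frobeniusPower` — THE p-UNIFORM FEDDER CERTIFICATE: `g_x^{p−1} ∈ (X₀^p, …, X₄^p)` for EVERY `p ≥ 2` (each term of the binomial expansion of
  `(z² + x⁷w)^{p−1}` has `z`-degree `2a ≥ p` or `x`-degree `7(p−1−a) ≥ p`); ★★ `pointFloor_b9_not_full` (`p ∤ 18`… in fact only `3 ≠ 0` is used) — for every blowing up of the point
  floor some stalk over the closed point is NOT `FullCl p` (✓ `PointFloorNotFullOfFedder.pointFloor_not_full`).
[folklore; cite: Fedder1983, Prop. 1.7 and Thm. 1.12] [cite: GortzWedhorn2020, Prop. 13.91] [cite: Temkin2008, §2.1]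
-/

-- single-problem summit: the doubled namespace component is forced
set_option linter.dupNamespace false

noncomputable section

namespace Summit.ResolutionOfSingularities.ResolutionOfSingularities.Theorems.FInjectiveMacaulayfication.B9PointFloorNotFull

open CategoryTheory CategoryTheory.Limits AlgebraicGeometry TopologicalSpace IsLocalRing MvPolynomial
open Literature.AlgebraicGeometry.Resolution
open Summit.ResolutionOfSingularities.ResolutionOfSingularities.Theorems.FInjectiveMacaulayfication
open SliceableCentre GermOfGlobalBlowup

variable (k : Type) [Field k]

/-! ## §1 The strict transforms of the point blow-up -/

/-- ★ **The chart identities** `θᵢ f = Xᵢ² · gᵢ` for `θᵢ : Xⱼ ↦ XⱼXᵢ (j ≠ i), Xᵢ ↦ Xᵢ`. [folklore] -/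
theorem theta (f : MvPolynomial (Fin 5) k) (hf : f = X 4 ^ 2 + X 0 ^ 9 + X 1 ^ 9 + X 2 ^ 9 + X 3 ^ 9) :
    ∀ i : Fin 5, aeval (fun j : Fin 5 => if j = i then (X i : MvPolynomial (Fin 5) k) else X j * X i) f =
      X i ^ ((fun _ : Fin 5 => 2) i) * (![X 4 ^ 2 + X 0 ^ 7 + X 0 ^ 7 * X 1 ^ 9 + X 0 ^ 7 * X 2 ^ 9 + X 0 ^ 7 * X 3 ^ 9,
        X 4 ^ 2 + X 1 ^ 7 * X 0 ^ 9 + X 1 ^ 7 + X 1 ^ 7 * X 2 ^ 9 + X 1 ^ 7 * X 3 ^ 9,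
        X 4 ^ 2 + X 2 ^ 7 * X 0 ^ 9 + X 2 ^ 7 * X 1 ^ 9 + X 2 ^ 7 + X 2 ^ 7 * X 3 ^ 9,
        X 4 ^ 2 + X 3 ^ 7 * X 0 ^ 9 + X 3 ^ 7 * X 1 ^ 9 + X 3 ^ 7 * X 2 ^ 9 + X 3 ^ 7,
        1 + X 4 ^ 7 * X 0 ^ 9 + X 4 ^ 7 * X 1 ^ 9 + X 4 ^ 7 * X 2 ^ 9 + X 4 ^ 7 * X 3 ^ 9] : Fin 5 → MvPolynomial (Fin 5) k) i := by
  intro i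
  subst hf
  fin_cases i <;> simp <;> ring

/-- `gᵢ ∉ (Xᵢ)` for every `i`: evaluate at `e_z` (`gᵢ = 1` there, `i ≤ 3`) resp. at `0` (`g_z(0) = 1`). [folklore] -/
theorem g_not_mem_span_X :
    ∀ i : Fin 5, (![X 4 ^ 2 + X 0 ^ 7 + X 0 ^ 7 * X 1 ^ 9 + X 0 ^ 7 * X 2 ^ 9 + X 0 ^ 7 * X 3 ^ 9,
        X 4 ^ 2 + X 1 ^ 7 * X 0 ^ 9 + X 1 ^ 7 + X 1 ^ 7 * X 2 ^ 9 + X 1 ^ 7 * X 3 ^ 9,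
        X 4 ^ 2 + X 2 ^ 7 * X 0 ^ 9 + X 2 ^ 7 * X 1 ^ 9 + X 2 ^ 7 + X 2 ^ 7 * X 3 ^ 9,
        X 4 ^ 2 + X 3 ^ 7 * X 0 ^ 9 + X 3 ^ 7 * X 1 ^ 9 + X 3 ^ 7 * X 2 ^ 9 + X 3 ^ 7,
        1 + X 4 ^ 7 * X 0 ^ 9 + X 4 ^ 7 * X 1 ^ 9 + X 4 ^ 7 * X 2 ^ 9 + X 4 ^ 7 * X 3 ^ 9] : Fin 5 → MvPolynomial (Fin 5) k) i ∉
      Ideal.span {(X i : MvPolynomial (Fin 5) k)} := by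
  intro i h
  rw [Ideal.mem_span_singleton] at h
  obtain ⟨c, hc⟩ := h
  fin_cases i
  · have := congrArg (MvPolynomial.eval (Pi.single 4 1 : Fin 5 → k)) hc; simp at this
  · have := congrArg (MvPolynomial.eval (Pi.single 4 1 : Fin 5 → k)) hc; simp at this
  · have := congrArg (MvPolynomial.eval (Pi.single 4 1 : Fin 5 → k)) hc; simp at this
  · have := congrArg (MvPolynomial.eval (Pi.single 4 1 : Fin 5 → k)) hc; simp at this
  · have := congrArg (MvPolynomial.eval (0 : Fin 5 → k)) hc; simp at this

/-- `g_x(0) = 0`: the origin of the `x`-chart lies on the strict transform. [folklore] -/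
theorem constantCoeff_g_zero : constantCoeff ((![X 4 ^ 2 + X 0 ^ 7 + X 0 ^ 7 * X 1 ^ 9 + X 0 ^ 7 * X 2 ^ 9 + X 0 ^ 7 * X 3 ^ 9,
        X 4 ^ 2 + X 1 ^ 7 * X 0 ^ 9 + X 1 ^ 7 + X 1 ^ 7 * X 2 ^ 9 + X 1 ^ 7 * X 3 ^ 9,
        X 4 ^ 2 + X 2 ^ 7 * X 0 ^ 9 + X 2 ^ 7 * X 1 ^ 9 + X 2 ^ 7 + X 2 ^ 7 * X 3 ^ 9,
        X 4 ^ 2 + X 3 ^ 7 * X 0 ^ 9 + X 3 ^ 7 * X 1 ^ 9 + X 3 ^ 7 * X 2 ^ 9 + X 3 ^ 7,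
        1 + X 4 ^ 7 * X 0 ^ 9 + X 4 ^ 7 * X 1 ^ 9 + X 4 ^ 7 * X 2 ^ 9 + X 4 ^ 7 * X 3 ^ 9] : Fin 5 → MvPolynomial (Fin 5) k) 0) = 0 := by
  simp [constantCoeff_X]

/-! ## §2 For EVERY blowing up along the point floor: legal -/

/-- ★ **THE POINT FLOOR OF B9 IS A LEGAL INPUT** (`2, 3 ≠ 0` in `k`): for every blowing up `g : S′ → Spec 𝒪_{X,v}` along `I = 𝔪̃|_{Spec 𝒪_{X,v}}`: `I ≠ ⊥`, `Supp I ⊆ (Reg)ᶜ`, `S′` regular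
off the closed fibre, CM everywhere — ONE application of ✓ `PointFloorLegalOfIsolated.pointFloor_input_legal`. [folklore assembly; cite: GortzWedhorn2020, Prop. 13.91 (2)] [cite: Temkin2008, §2.1] -/
theorem pointFloor_b9_input_legal (h2 : (2 : k) ≠ 0) (h3 : (3 : k) ≠ 0) (f : MvPolynomial (Fin 5) k) (hf : f = X 4 ^ 2 + X 0 ^ 9 + X 1 ^ 9 + X 2 ^ 9 + X 3 ^ 9)
    (v : Spec (.of (MvPolynomial (Fin 5) k ⧸ Ideal.span {f})))
    (hv : v.asIdeal = Ideal.span (Set.range (fun j : Fin 5 => Ideal.Quotient.mk (Ideal.span {f}) (X j))))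
    (S' : Scheme.{0}) (g : S' ⟶ Spec ((Spec (.of (MvPolynomial (Fin 5) k ⧸ Ideal.span {f}))).presheaf.stalk v))
    (hg : IsBlowup g ((affineBlowup.idealSheaf (Ideal.span (Set.range (fun j : Fin 5 => Ideal.Quotient.mk (Ideal.span {f}) (X j))))).comap ((Spec (.of (MvPolynomial (Fin 5) k ⧸ Ideal.span {f}))).fromSpecStalk v))) :
    ((affineBlowup.idealSheaf (Ideal.span (Set.range (fun j : Fin 5 => Ideal.Quotient.mk (Ideal.span {f}) (X j))))).comap ((Spec (.of (MvPolynomial (Fin 5) k ⧸ Ideal.span {f}))).fromSpecStalk v)) ≠ ⊥ ∧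
    (((((affineBlowup.idealSheaf (Ideal.span (Set.range (fun j : Fin 5 => Ideal.Quotient.mk (Ideal.span {f}) (X j))))).comap ((Spec (.of (MvPolynomial (Fin 5) k ⧸ Ideal.span {f}))).fromSpecStalk v))).support :
        Set (Spec ((Spec (.of (MvPolynomial (Fin 5) k ⧸ Ideal.span {f}))).presheaf.stalk v))) ⊆ (Scheme.regularLocus (Spec ((Spec (.of (MvPolynomial (Fin 5) k ⧸ Ideal.span {f}))).presheaf.stalk v)))ᶜ) ∧
    (∀ s : S', g.base s ≠ closedPoint ((Spec (.of (MvPolynomial (Fin 5) k ⧸ Ideal.span {f}))).presheaf.stalk v) → s ∈ Scheme.regularLocus S') ∧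
    (∀ s : S', CMCl (S'.presheaf.stalk s)) :=
  PointFloorLegalOfIsolated.pointFloor_input_legal k f (B9Specimen.prime_f k h3 f hf) (by norm_num) (fun _ : Fin 5 => 2) _ (theta k f hf)
    (B9Specimen.f_not_mem_span_X k f hf) (g_not_mem_span_X k) v hv (B9Specimen.vertex_not_mem_regularLocus k h3 f hf v hv)
    (B9Specimen.regular_of_ne_vertex k h2 h3 f hf v hv) S' g hg

/-! ## §3 ★★ For EVERY blowing up along the point floor: NOT FULL, for every prime `p` (with `3 ≠ 0`) -/

/-- ★★ **THE p-UNIFORM FEDDER CERTIFICATE OF THE `x`-CHART**: `(z² + x⁷(1 + y⁹ + u⁹ + t⁹))^{p−1} ∈ (X₀^p, …, X₄^p)` for EVERY `p ≥ 2`: in the binomial expansion the term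
`C·z^{2a}·(x⁷w)^{p−1−a}` has `2a ≥ p` or else `7(p−1−a) ≥ p` (since `2a ≤ p − 1` forces `p − 1 − a ≥ (p−1)/2` and `7(p−1)/2 ≥ p` for `p ≥ 2`). [OURS · certificate; cite: Fedder1983, Prop. 1.7] -/
theorem g_zero_pow_mem_frobeniusPower (p : ℕ) (hp : 2 ≤ p) :
    ((![X 4 ^ 2 + X 0 ^ 7 + X 0 ^ 7 * X 1 ^ 9 + X 0 ^ 7 * X 2 ^ 9 + X 0 ^ 7 * X 3 ^ 9,
        X 4 ^ 2 + X 1 ^ 7 * X 0 ^ 9 + X 1 ^ 7 + X 1 ^ 7 * X 2 ^ 9 + X 1 ^ 7 * X 3 ^ 9,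
        X 4 ^ 2 + X 2 ^ 7 * X 0 ^ 9 + X 2 ^ 7 * X 1 ^ 9 + X 2 ^ 7 + X 2 ^ 7 * X 3 ^ 9,
        X 4 ^ 2 + X 3 ^ 7 * X 0 ^ 9 + X 3 ^ 7 * X 1 ^ 9 + X 3 ^ 7 * X 2 ^ 9 + X 3 ^ 7,
        1 + X 4 ^ 7 * X 0 ^ 9 + X 4 ^ 7 * X 1 ^ 9 + X 4 ^ 7 * X 2 ^ 9 + X 4 ^ 7 * X 3 ^ 9] : Fin 5 → MvPolynomial (Fin 5) k) 0) ^ (p - 1) ∈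
      Ideal.span (Set.range fun i : Fin 5 => (X i : MvPolynomial (Fin 5) k) ^ p) := by
  have hx : (X 0 : MvPolynomial (Fin 5) k) ^ p ∈ Ideal.span (Set.range fun i : Fin 5 => (X i : MvPolynomial (Fin 5) k) ^ p) := Ideal.subset_span ⟨0, rfl⟩
  have hz : (X 4 : MvPolynomial (Fin 5) k) ^ p ∈ Ideal.span (Set.range fun i : Fin 5 => (X i : MvPolynomial (Fin 5) k) ^ p) := Ideal.subset_span ⟨4, rfl⟩
  have hfac : ((![X 4 ^ 2 + X 0 ^ 7 + X 0 ^ 7 * X 1 ^ 9 + X 0 ^ 7 * X 2 ^ 9 + X 0 ^ 7 * X 3 ^ 9,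
        X 4 ^ 2 + X 1 ^ 7 * X 0 ^ 9 + X 1 ^ 7 + X 1 ^ 7 * X 2 ^ 9 + X 1 ^ 7 * X 3 ^ 9,
        X 4 ^ 2 + X 2 ^ 7 * X 0 ^ 9 + X 2 ^ 7 * X 1 ^ 9 + X 2 ^ 7 + X 2 ^ 7 * X 3 ^ 9,
        X 4 ^ 2 + X 3 ^ 7 * X 0 ^ 9 + X 3 ^ 7 * X 1 ^ 9 + X 3 ^ 7 * X 2 ^ 9 + X 3 ^ 7,
        1 + X 4 ^ 7 * X 0 ^ 9 + X 4 ^ 7 * X 1 ^ 9 + X 4 ^ 7 * X 2 ^ 9 + X 4 ^ 7 * X 3 ^ 9] : Fin 5 → MvPolynomial (Fin 5) k) 0) =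
      X 4 ^ 2 + X 0 ^ 7 * (1 + X 1 ^ 9 + X 2 ^ 9 + X 3 ^ 9) := by
    simp only [Matrix.cons_val_zero]
    ring
  rw [hfac, add_pow]
  refine Ideal.sum_mem _ fun m hm => ?_
  rw [Finset.mem_range] at hm
  by_cases h2m : p ≤ 2 * m
  · -- the `z`-degree is at least `p`
    have e1 : ((X 4 : MvPolynomial (Fin 5) k) ^ 2) ^ m = X 4 ^ p * X 4 ^ (2 * m - p) := by
      rw [← pow_mul, ← pow_add]
      congr 1
      omega
    rw [e1, mul_assoc, mul_assoc]
    exact Ideal.mul_mem_right _ _ hz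
  · -- the `x`-degree is at least `p`
    have hb : p ≤ 7 * (p - 1 - m) := by omega
    have e2 : ((X 0 : MvPolynomial (Fin 5) k) ^ 7 * (1 + X 1 ^ 9 + X 2 ^ 9 + X 3 ^ 9)) ^ (p - 1 - m) =
        X 0 ^ p * (X 0 ^ (7 * (p - 1 - m) - p) * (1 + X 1 ^ 9 + X 2 ^ 9 + X 3 ^ 9) ^ (p - 1 - m)) := by
      rw [mul_pow, ← pow_mul, ← mul_assoc, ← pow_add]
      congr 2
      omega
    rw [e2, mul_comm (((X 4 : MvPolynomial (Fin 5) k) ^ 2) ^ m), mul_assoc, mul_assoc]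
    exact Ideal.mul_mem_right _ _ hx

/-- ★★ **THE POINT FLOOR OF B9 IS NOT FULL, FOR EVERY PRIME `p` WITH `3 ≠ 0` IN `k`**: for every blowing up `g : S′ → Spec 𝒪_{X,v}` along the point floor there is a point
`s ∈ S′` over the closed point whose local ring is NOT `FullCl p` (the origin of the `x`-chart, Fedder certificate `g_zero_pow_mem_frobeniusPower`) — ONE application of ✓
`PointFloorNotFullOfFedder.pointFloor_not_full`. [OURS · p-uniform negative certificate; cite: Fedder1983, Thm. 1.12] -/
theorem pointFloor_b9_not_full (p : ℕ) [Fact p.Prime] [CharP k p] (h3 : (3 : k) ≠ 0) (f : MvPolynomial (Fin 5) k) (hf : f = X 4 ^ 2 + X 0 ^ 9 + X 1 ^ 9 + X 2 ^ 9 + X 3 ^ 9)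
    (v : Spec (.of (MvPolynomial (Fin 5) k ⧸ Ideal.span {f})))
    (hv : v.asIdeal = Ideal.span (Set.range (fun j : Fin 5 => Ideal.Quotient.mk (Ideal.span {f}) (X j))))
    (S' : Scheme.{0}) (g : S' ⟶ Spec ((Spec (.of (MvPolynomial (Fin 5) k ⧸ Ideal.span {f}))).presheaf.stalk v))
    (hg : IsBlowup g ((affineBlowup.idealSheaf (Ideal.span (Set.range (fun j : Fin 5 => Ideal.Quotient.mk (Ideal.span {f}) (X j))))).comap ((Spec (.of (MvPolynomial (Fin 5) k ⧸ Ideal.span {f}))).fromSpecStalk v))) :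
    ∃ s : S', g.base s = closedPoint ((Spec (.of (MvPolynomial (Fin 5) k ⧸ Ideal.span {f}))).presheaf.stalk v) ∧ ¬ FullCl p (S'.presheaf.stalk s) :=
  PointFloorNotFullOfFedder.pointFloor_not_full p k f (B9Specimen.prime_f k h3 f hf) (fun _ : Fin 5 => 2) _ (theta k f hf)
    (B9Specimen.f_not_mem_span_X k f hf) (g_not_mem_span_X k) (B9Specimen.constantCoeff_f k f hf) 0 (constantCoeff_g_zero k)
    (g_zero_pow_mem_frobeniusPower k p (Fact.out : p.Prime).two_le) v hv S' g hg

end Summit.ResolutionOfSingularities.ResolutionOfSingularities.Theorems.FInjectiveMacaulayfication.B9PointFloorNotFull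

end
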